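import Literature.Analysis.Fourier.HilbertTransformLineL2Density
import Literature.Analysis.Fourier.HilbertTransformLineSplit
import Mathlib.Analysis.SpecialFunctions.Integrability.Basic
import Mathlib.Analysis.SpecialFunctions.ImproperIntegrals
import Mathlib.MeasureTheory.Measure.Haar.NormedSpace
import Mathlib.MeasureTheory.Integral.IntervalIntegral.FundThmCalculus
import Mathlib.MeasureTheory.Integral.DominatedConvergence
import Mathlib.MeasureTheory.Function.LocallyIntegrable
import HarnessLib

/-!
# SHEET-ℝ weak→classical bridge, part 1: the p.v. Hilbert transform of an `H¹`-type profile, and continuity of `Hf` for `f ∈ C¹ ∩ L¹`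

HONEST FRAMING (cell ns-blowup GROUP B / zone Z3, case Z3-SR-CERT; 1-D MODEL (viscous gCLM/OSW on the line); not Euler/NS;
«violates: none — MODEL»). Nothing here asserts that a profile exists.

The certificate of record (`CertificateViscousSheetR.lean`, `CertificateViscousSheetRChain.lean`) produces a zero of the profile map
`G(Ω) = Ω + ½ξΩ′ + a𝒰Ω·Ω′ − (HΩ)Ω − νΩ″` in the ENERGY space `E = H¹_{L²+ξ²}` and in the WEAK (`E*`) sense; the blow-up theorem
`SheetRStrongZeroBlowup.exact_viscous_selfSimilar_blowup_of_strongZero` wants a `C² ∩ L¹` STRONG zero.  This file supplies the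
calculus of the bootstrap between the two (the bootstrap itself is `SheetRWeakToStrong.lean`):

* §1 — an `H¹`-type profile is written as a primitive `Ω = Ω(0) + ∫₀^ξ Ω₁` with `Ω₁ ∈ L²`; for such `Ω ∈ L¹` the symmetric
  principal-value integrand `t ↦ (Ω(x−t) − Ω(x+t))/t` of the tree's pointwise operator `hilbertTransform` is integrable on `(0,∞)` at
  EVERY point (`integrableOn_symmIntegrand_of_primitive`: near `t = 0` by the pointwise AM–GM bound `|Ω(x−t) − Ω(x+t)| ≤ (1 + ½‖Ω₁‖₂²)√t`
  of `SheetRPVIntegrable`, run on the primitive instead of a `C¹` function; far out by `|Ω(x∓t)|/t ≤ |Ω(x∓t)|`), so `HΩ` IS the genuine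
  principal value everywhere, `HΩ ∈ L²` by the tree's M. Riesz theorem (`memLp_two_hilbertTransform_of_primitive`) and `HΩ ∈ L¹_loc`;
* §2 — for `f ∈ C¹ ∩ L¹` the function `x ↦ hilbertTransform f x` is CONTINUOUS (`continuous_hilbertTransform_of_contDiff`): the near piece
  `∫_{(0,1]} (f(x−t) − f(x+t))/t dt` is dominated by a local bound of `|f′|` (mean value theorem), the far piece, after the substitutions
  `s = x ± t`, by `|f| ∈ L¹`.
Pure calculus about the tree's operator; no definition, no named fact; MODEL frame bookkeeping only. WHAT THIS IS NOT: not NS.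
-/

noncomputable section

namespace Summit.NavierStokesRegularity.OSWSelfSimilar
namespace SheetRWeakProfilePV

open _root_.MeasureTheory _root_.Set _root_.Filter Literature.Analysis.Fourier
open scoped Real Topology

/-! ### §1. `H¹`-type profiles `Ω = Ω(0) + ∫₀ Ω₁`, `Ω₁ ∈ L²` -/

/-- Local integrability of an `L²` function on the line (every `p ≥ 1` would do). [folklore] -/
theorem intervalIntegrable_of_memLp_two {g : ℝ → ℝ} (hg : MemLp g 2) (a b : ℝ) : IntervalIntegrable g volume a b :=
  ((hg.locallyIntegrable one_le_two).integrableOn_isCompact isCompact_uIcc).intervalIntegrable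

/-- A primitive `Ω = Ω(0) + ∫₀ Ω₁` of a locally integrable `Ω₁` is continuous. [folklore] -/
theorem continuous_of_primitive {Ω Ω₁ : ℝ → ℝ} (hΩ : ∀ x, Ω x = Ω 0 + ∫ s in (0 : ℝ)..x, Ω₁ s)
    (hΩ₁ : ∀ a b, IntervalIntegrable Ω₁ volume a b) : Continuous Ω := by
  have h : Ω = fun x => Ω 0 + ∫ s in (0 : ℝ)..x, Ω₁ s := funext hΩ
  rw [h]
  exact continuous_const.add (intervalIntegral.continuous_primitive hΩ₁ 0)

/-- Increments of a primitive: `Ω(b) − Ω(a) = ∫ₐᵇ Ω₁`. [folklore] -/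
theorem sub_eq_integral_of_primitive {Ω Ω₁ : ℝ → ℝ} (hΩ : ∀ x, Ω x = Ω 0 + ∫ s in (0 : ℝ)..x, Ω₁ s)
    (hΩ₁ : ∀ a b, IntervalIntegrable Ω₁ volume a b) (a b : ℝ) : Ω b - Ω a = ∫ s in a..b, Ω₁ s := by
  rw [hΩ b, hΩ a, add_sub_add_left_eq_sub, intervalIntegral.integral_interval_sub_left (hΩ₁ 0 b) (hΩ₁ 0 a)]

/-- Pointwise AM–GM: `|d| ≤ (s + s⁻¹·d²)/2` for `s > 0`. [folklore] -/
private theorem abs_le_half_add {d s : ℝ} (hs : 0 < s) : |d| ≤ (s + s⁻¹ * d ^ 2) / 2 := by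
  have key : 2 * s * |d| ≤ s ^ 2 + d ^ 2 := by nlinarith [sq_nonneg (s - |d|), sq_abs d, abs_nonneg d]
  rw [le_div_iff₀ (by norm_num : (0 : ℝ) < 2)]
  have h2 : s + s⁻¹ * d ^ 2 = (s ^ 2 + d ^ 2) / s := by field_simp
  rw [h2, le_div_iff₀ hs]
  linarith

/-- **Near bound for a primitive.** If `Ω = Ω(0) + ∫₀ Ω₁` with `Ω₁` locally integrable and `A := ∫ Ω₁² < ∞`, then for `0 < t`:
`|Ω(x−t) − Ω(x+t)| ≤ (1 + A/2)·√t` (pointwise AM–GM `2|Ω₁| ≤ s + Ω₁²/s` at `s = t^{−1/2}`, no Hölder). [folklore] -/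
theorem abs_sub_le_sqrt_of_primitive {Ω Ω₁ : ℝ → ℝ} (hΩ : ∀ x, Ω x = Ω 0 + ∫ s in (0 : ℝ)..x, Ω₁ s)
    (hΩ₁ : ∀ a b, IntervalIntegrable Ω₁ volume a b) (h1 : Integrable (fun y => Ω₁ y ^ 2)) {t : ℝ} (ht : 0 < t) (x : ℝ) :
    |Ω (x - t) - Ω (x + t)| ≤ (1 + (∫ y, Ω₁ y ^ 2) / 2) * Real.sqrt t := by
  set A : ℝ := ∫ y, Ω₁ y ^ 2 with hA
  have hab : x - t ≤ x + t := by linarith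
  have hftc : ∫ y in (x - t)..(x + t), Ω₁ y = Ω (x + t) - Ω (x - t) :=
    (sub_eq_integral_of_primitive hΩ hΩ₁ (x - t) (x + t)).symm
  have hst : 0 < Real.sqrt t := Real.sqrt_pos.mpr ht
  set s : ℝ := (Real.sqrt t)⁻¹ with hs_def
  have hs : 0 < s := inv_pos.mpr hst
  have h2 : |∫ y in (x - t)..(x + t), Ω₁ y| ≤ ∫ y in (x - t)..(x + t), |Ω₁ y| :=
    intervalIntegral.abs_integral_le_integral_abs hab
  have hI2 : IntervalIntegrable (fun y => s⁻¹ * Ω₁ y ^ 2) volume (x - t) (x + t) :=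
    (h1.intervalIntegrable (μ := volume) (a := x - t) (b := x + t)).const_mul s⁻¹
  have hI3 : IntervalIntegrable (fun y => (s + s⁻¹ * Ω₁ y ^ 2) / 2) volume (x - t) (x + t) :=
    (intervalIntegrable_const.add hI2).div_const 2
  have hIabs : IntervalIntegrable (fun y => |Ω₁ y|) volume (x - t) (x + t) := (hΩ₁ (x - t) (x + t)).abs
  have h3 : ∫ y in (x - t)..(x + t), |Ω₁ y| ≤ ∫ y in (x - t)..(x + t), (s + s⁻¹ * Ω₁ y ^ 2) / 2 :=
    intervalIntegral.integral_mono_on hab hIabs hI3 fun y _ => abs_le_half_add hs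
  have h4a : ∫ y in (x - t)..(x + t), (s + s⁻¹ * Ω₁ y ^ 2) / 2
      = (∫ y in (x - t)..(x + t), (s + s⁻¹ * Ω₁ y ^ 2)) / 2 := intervalIntegral.integral_div _ _
  have h4b : ∫ y in (x - t)..(x + t), (s + s⁻¹ * Ω₁ y ^ 2)
      = (∫ _y in (x - t)..(x + t), s) + ∫ y in (x - t)..(x + t), s⁻¹ * Ω₁ y ^ 2 :=
    intervalIntegral.integral_add intervalIntegrable_const hI2
  have h4c : ∫ _y in (x - t)..(x + t), s = (x + t - (x - t)) • s := intervalIntegral.integral_const _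
  have h4d : ∫ y in (x - t)..(x + t), s⁻¹ * Ω₁ y ^ 2 = s⁻¹ * ∫ y in (x - t)..(x + t), Ω₁ y ^ 2 :=
    intervalIntegral.integral_const_mul _ _
  have h4 : ∫ y in (x - t)..(x + t), (s + s⁻¹ * Ω₁ y ^ 2) / 2
      = (s * (2 * t) + s⁻¹ * ∫ y in (x - t)..(x + t), Ω₁ y ^ 2) / 2 := by
    rw [h4a, h4b, h4c, h4d, smul_eq_mul]
    ring
  have h5 : ∫ y in (x - t)..(x + t), Ω₁ y ^ 2 ≤ A := by
    rw [intervalIntegral.integral_of_le hab]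
    exact setIntegral_le_integral h1 (Eventually.of_forall fun y => sq_nonneg _)
  have h6 : |Ω (x - t) - Ω (x + t)| ≤ (s * (2 * t) + s⁻¹ * A) / 2 := by
    rw [abs_sub_comm, ← hftc]
    calc |∫ y in (x - t)..(x + t), Ω₁ y| ≤ ∫ y in (x - t)..(x + t), (s + s⁻¹ * Ω₁ y ^ 2) / 2 := h2.trans h3
      _ = (s * (2 * t) + s⁻¹ * ∫ y in (x - t)..(x + t), Ω₁ y ^ 2) / 2 := h4
      _ ≤ (s * (2 * t) + s⁻¹ * A) / 2 := by gcongr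
  have ht' : Real.sqrt t * Real.sqrt t = t := Real.mul_self_sqrt ht.le
  calc |Ω (x - t) - Ω (x + t)| ≤ (s * (2 * t) + s⁻¹ * A) / 2 := h6
    _ = (1 + A / 2) * Real.sqrt t := by
        rw [hs_def, inv_inv]
        field_simp
        nlinarith [ht']

/-- **The symmetric p.v. integrand of an `H¹`-type `L¹` profile is integrable on `(0,∞)` at EVERY point**: for
`Ω = Ω(0) + ∫₀ Ω₁` with `Ω₁ ∈ L²` and `Ω ∈ L¹`, `t ↦ (Ω(x−t) − Ω(x+t))/t ∈ L¹(0,∞)` for all `x` — so `hilbertTransform Ω x`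
is the genuine principal value everywhere. [folklore] -/
theorem integrableOn_symmIntegrand_of_primitive {Ω Ω₁ : ℝ → ℝ} (hΩ : ∀ x, Ω x = Ω 0 + ∫ s in (0 : ℝ)..x, Ω₁ s)
    (hΩ₁ : MemLp Ω₁ 2) (hΩi : Integrable Ω) (x : ℝ) :
    IntegrableOn (fun t => (Ω (x - t) - Ω (x + t)) / t) (Ioi 0) := by
  have hii : ∀ a b, IntervalIntegrable Ω₁ volume a b := intervalIntegrable_of_memLp_two hΩ₁
  have h1 : Integrable (fun y => Ω₁ y ^ 2) := hΩ₁.integrable_sq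
  have hc : Continuous Ω := continuous_of_primitive hΩ hii
  set A : ℝ := ∫ y, Ω₁ y ^ 2 with hA
  have hmeas : AEStronglyMeasurable (fun t => (Ω (x - t) - Ω (x + t)) / t) volume :=
    (((hc.comp (continuous_const.sub continuous_id)).sub (hc.comp (continuous_const.add continuous_id))).measurable.div
      measurable_id).aestronglyMeasurable
  have hsplit : Ioi (0 : ℝ) = Ioc 0 1 ∪ Ioi 1 := (Ioc_union_Ioi_eq_Ioi zero_le_one).symm
  rw [hsplit]
  refine IntegrableOn.union ?_ ?_
  · -- near piece: domination by (1 + A/2) t^{-1/2}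
    have hdom : IntegrableOn (fun t : ℝ => (1 + A / 2) * t ^ (-(1 / 2 : ℝ))) (Ioc 0 1) := by
      have h := (intervalIntegral.intervalIntegrable_rpow' (a := 0) (b := 1) (r := -(1 / 2 : ℝ)) (by norm_num)).const_mul
        (1 + A / 2)
      exact (intervalIntegrable_iff_integrableOn_Ioc_of_le zero_le_one).mp h
    refine Integrable.mono' hdom hmeas.restrict ?_
    refine ae_restrict_of_forall_mem measurableSet_Ioc fun t ht => ?_
    have ht0 : 0 < t := ht.1
    rw [Real.norm_eq_abs, abs_div, abs_of_pos ht0, div_le_iff₀ ht0]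
    have hb := abs_sub_le_sqrt_of_primitive hΩ hii h1 ht0 x
    have hrpow : t ^ (-(1 / 2 : ℝ)) * t = Real.sqrt t := by
      rw [Real.sqrt_eq_rpow, show -(1 / 2 : ℝ) = (1 / 2 : ℝ) - 1 by norm_num, Real.rpow_sub_one ht0.ne']
      field_simp
    calc |Ω (x - t) - Ω (x + t)| ≤ (1 + A / 2) * Real.sqrt t := hb
      _ = (1 + A / 2) * t ^ (-(1 / 2 : ℝ)) * t := by rw [mul_assoc, hrpow]
  · -- far piece: domination by |Ω(x−t)| + |Ω(x+t)| (here `Ω ∈ L¹` and `t > 1`)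
    have hL : Integrable (fun t : ℝ => Ω (x - t)) := hΩi.comp_sub_left x
    have hR : Integrable (fun t : ℝ => Ω (x + t)) := hΩi.comp_add_left x
    have hdom : IntegrableOn (fun t : ℝ => |Ω (x - t)| + |Ω (x + t)|) (Ioi 1) := (hL.abs.add hR.abs).integrableOn
    refine Integrable.mono' hdom hmeas.restrict ?_
    refine ae_restrict_of_forall_mem measurableSet_Ioi fun t ht => ?_
    have ht1 : 1 < t := ht
    have ht0 : 0 < t := by linarith
    rw [Real.norm_eq_abs, abs_div, abs_of_pos ht0, div_le_iff₀ ht0]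
    have hs : |Ω (x - t) - Ω (x + t)| ≤ |Ω (x - t)| + |Ω (x + t)| := abs_sub _ _
    have hp : 0 ≤ |Ω (x - t)| + |Ω (x + t)| := by positivity
    nlinarith

/-- Hence **`HΩ ∈ L²` with `‖HΩ‖₂ = ‖Ω‖₂`** for an `H¹`-type profile `Ω ∈ L¹ ∩ L²` (the tree's M. Riesz theorem
`eLpNorm_hilbertTransform_eq_of_memLp`, whose p.v. hypothesis is `integrableOn_symmIntegrand_of_primitive`). [folklore] -/
theorem memLp_two_hilbertTransform_of_primitive {Ω Ω₁ : ℝ → ℝ} (hΩ : ∀ x, Ω x = Ω 0 + ∫ s in (0 : ℝ)..x, Ω₁ s)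
    (hΩ₁ : MemLp Ω₁ 2) (hΩi : Integrable Ω) (hΩ2 : MemLp Ω 2) :
    MemLp (hilbertTransform Ω) 2 ∧ eLpNorm (hilbertTransform Ω) 2 volume = eLpNorm Ω 2 volume :=
  eLpNorm_hilbertTransform_eq_of_memLp hΩ2 (integrableOn_symmIntegrand_of_primitive hΩ hΩ₁ hΩi)

/-- … and `HΩ` is locally integrable, so that the velocity `𝒰Ω(ξ) = ∫₀^ξ HΩ` is a genuine continuous primitive. [folklore] -/
theorem intervalIntegrable_hilbertTransform_of_primitive {Ω Ω₁ : ℝ → ℝ} (hΩ : ∀ x, Ω x = Ω 0 + ∫ s in (0 : ℝ)..x, Ω₁ s)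
    (hΩ₁ : MemLp Ω₁ 2) (hΩi : Integrable Ω) (hΩ2 : MemLp Ω 2) (a b : ℝ) :
    IntervalIntegrable (hilbertTransform Ω) volume a b :=
  intervalIntegrable_of_memLp_two (memLp_two_hilbertTransform_of_primitive hΩ hΩ₁ hΩi hΩ2).1 a b

/-- The velocity `ξ ↦ ∫₀^ξ HΩ` of an `H¹`-type `L¹ ∩ L²` profile is continuous. [folklore] -/
theorem continuous_velocity_of_primitive {Ω Ω₁ : ℝ → ℝ} (hΩ : ∀ x, Ω x = Ω 0 + ∫ s in (0 : ℝ)..x, Ω₁ s)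
    (hΩ₁ : MemLp Ω₁ 2) (hΩi : Integrable Ω) (hΩ2 : MemLp Ω 2) :
    Continuous fun ξ => ∫ s in (0 : ℝ)..ξ, hilbertTransform Ω s :=
  intervalIntegral.continuous_primitive (intervalIntegrable_hilbertTransform_of_primitive hΩ hΩ₁ hΩi hΩ2) 0

/-! ### §2. Continuity of `hilbertTransform f` for `f ∈ C¹ ∩ L¹` -/

/-- Local mean-value bound: if `|f′| ≤ M` on `[x₀ − 2, x₀ + 2]`, then for `|x − x₀| < 1` and `t ∈ (0, 1]`,
`|f(x − t) − f(x + t)|/t ≤ 2M`. [folklore] -/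
private theorem abs_symm_le_of_deriv_bound {f : ℝ → ℝ} (hf : Differentiable ℝ f) {x₀ M : ℝ}
    (hM : ∀ y ∈ Icc (x₀ - 2) (x₀ + 2), |deriv f y| ≤ M) {x t : ℝ} (hx : dist x x₀ < 1) (ht : t ∈ Ioc (0 : ℝ) 1) :
    |(f (x - t) - f (x + t)) / t| ≤ 2 * M := by
  have ht0 : 0 < t := ht.1
  have hx' : |x - x₀| < 1 := by rwa [← Real.dist_eq]
  have hxl : x₀ - 1 < x ∧ x < x₀ + 1 := by constructor <;> linarith [abs_lt.1 hx']
  have hsub : Icc (x - t) (x + t) ⊆ Icc (x₀ - 2) (x₀ + 2) := by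
    intro y hy; exact ⟨by linarith [hy.1, ht.2], by linarith [hy.2, ht.2]⟩
  have hmvt : ‖f (x + t) - f (x - t)‖ ≤ M * ‖(x + t) - (x - t)‖ :=
    (convex_Icc (x - t) (x + t)).norm_image_sub_le_of_norm_deriv_le (fun y _ => hf.differentiableAt)
      (fun y hy => by rw [Real.norm_eq_abs]; exact hM y (hsub hy))
      (left_mem_Icc.2 (by linarith)) (right_mem_Icc.2 (by linarith))
  rw [Real.norm_eq_abs, Real.norm_eq_abs, show x + t - (x - t) = 2 * t by ring, abs_of_pos (by linarith : (0:ℝ) < 2 * t)] at hmvt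
  rw [abs_div, abs_of_pos ht0, div_le_iff₀ ht0, abs_sub_comm]
  linarith

/-- The near piece `x ↦ ∫_{(0,1]} (f(x−t) − f(x+t))/t dt` is continuous for `f ∈ C¹`. [folklore] -/
theorem continuous_nearPiece {f : ℝ → ℝ} (hf : ContDiff ℝ 1 f) :
    Continuous fun x => ∫ t in Ioc (0 : ℝ) 1, (f (x - t) - f (x + t)) / t := by
  have hc : Continuous f := hf.continuous
  have hd : Differentiable ℝ f := hf.differentiable one_ne_zero
  have hc' : Continuous (deriv f) := hf.continuous_deriv le_rfl
  refine continuous_iff_continuousAt.2 fun x₀ => ?_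
  -- a bound of |f′| on [x₀ − 2, x₀ + 2]
  obtain ⟨M, hM⟩ := isCompact_Icc.exists_bound_of_continuousOn (hc'.continuousOn (s := Icc (x₀ - 2) (x₀ + 2)))
  have hM' : ∀ y ∈ Icc (x₀ - 2) (x₀ + 2), |deriv f y| ≤ M := fun y hy => by rw [← Real.norm_eq_abs]; exact hM y hy
  refine continuousAt_of_dominated (bound := fun _ => 2 * M) ?_ ?_ ?_ ?_
  · refine Eventually.of_forall fun x => ?_
    exact (((hc.comp (continuous_const.sub continuous_id)).sub (hc.comp (continuous_const.add continuous_id))).measurable.div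
      measurable_id).aestronglyMeasurable.restrict
  · have hball : ∀ᶠ x in 𝓝 x₀, dist x x₀ < 1 := Metric.ball_mem_nhds x₀ one_pos
    filter_upwards [hball] with x hx
    refine ae_restrict_of_forall_mem measurableSet_Ioc fun t ht => ?_
    rw [Real.norm_eq_abs]
    exact abs_symm_le_of_deriv_bound hd hM' hx ht
  · exact integrableOn_const (by simp)
  · refine Eventually.of_forall fun t => ?_
    exact (((hc.comp (continuous_id.sub continuous_const)).sub (hc.comp (continuous_id.add continuous_const))).div_const t).continuousAt

/-- Substitution `s = x + t` in the right far piece: `∫_{t>1} f(x+t)/t dt = ∫ 𝟙_{s > x+1} f(s)/(s − x) ds`. [folklore] -/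
theorem farPiece_right_eq (f : ℝ → ℝ) (x : ℝ) :
    ∫ t in Ioi (1 : ℝ), f (x + t) / t = ∫ s, (Ioi (x + 1)).indicator (fun s => f s / (s - x)) s := by
  rw [← integral_indicator measurableSet_Ioi]
  have h : (Ioi (1 : ℝ)).indicator (fun t => f (x + t) / t) = fun t => (Ioi (x + 1)).indicator (fun s => f s / (s - x)) (x + t) := by
    funext t
    by_cases ht : t ∈ Ioi (1 : ℝ)
    · have hxt : x + t ∈ Ioi (x + 1) := by simp only [mem_Ioi] at ht ⊢; linarith
      rw [indicator_of_mem ht, indicator_of_mem hxt, add_sub_cancel_left]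
    · have hxt : x + t ∉ Ioi (x + 1) := by simp only [mem_Ioi, not_lt] at ht ⊢; linarith
      rw [indicator_of_notMem ht, indicator_of_notMem hxt]
  rw [h]
  exact integral_add_left_eq_self (fun s => (Ioi (x + 1)).indicator (fun s => f s / (s - x)) s) x

/-- Substitution `s = x − t` in the left far piece: `∫_{t>1} f(x−t)/t dt = ∫ 𝟙_{s < x−1} f(s)/(x − s) ds`. [folklore] -/
theorem farPiece_left_eq (f : ℝ → ℝ) (x : ℝ) :
    ∫ t in Ioi (1 : ℝ), f (x - t) / t = ∫ s, (Iio (x - 1)).indicator (fun s => f s / (x - s)) s := by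
  rw [← integral_indicator measurableSet_Ioi]
  have h : (Ioi (1 : ℝ)).indicator (fun t => f (x - t) / t) = fun t => (Iio (x - 1)).indicator (fun s => f s / (x - s)) (x - t) := by
    funext t
    by_cases ht : t ∈ Ioi (1 : ℝ)
    · have hxt : x - t ∈ Iio (x - 1) := by simp only [mem_Ioi, mem_Iio] at ht ⊢; linarith
      rw [indicator_of_mem ht, indicator_of_mem hxt, sub_sub_cancel]
    · have hxt : x - t ∉ Iio (x - 1) := by simp only [mem_Ioi, mem_Iio, not_lt] at ht ⊢; linarith
      rw [indicator_of_notMem ht, indicator_of_notMem hxt]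
  rw [h]
  exact integral_sub_left_eq_self (fun s => (Iio (x - 1)).indicator (fun s => f s / (x - s)) s) volume x

/-- The right far piece `x ↦ ∫ 𝟙_{s > x+1} f(s)/(s − x) ds` is continuous for `f ∈ L¹` continuous (domination by `|f|`). [folklore] -/
theorem continuous_farPiece_right {f : ℝ → ℝ} (hc : Continuous f) (hfi : Integrable f) :
    Continuous fun x => ∫ s, (Ioi (x + 1)).indicator (fun s => f s / (s - x)) s := by
  refine continuous_iff_continuousAt.2 fun x₀ => ?_
  refine continuousAt_of_dominated (bound := fun s => |f s|) ?_ ?_ hfi.abs ?_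
  · refine Eventually.of_forall fun x => ?_
    exact ((hc.measurable.div (measurable_id.sub measurable_const)).aestronglyMeasurable.indicator measurableSet_Ioi)
  · refine Eventually.of_forall fun x => Eventually.of_forall fun s => ?_
    rw [Real.norm_eq_abs]
    by_cases hs : s ∈ Ioi (x + 1)
    · rw [indicator_of_mem hs, abs_div]
      have hsx : 1 < s - x := by simp only [mem_Ioi] at hs; linarith
      rw [abs_of_pos (by linarith : (0:ℝ) < s - x)]
      calc |f s| / (s - x) ≤ |f s| / 1 := div_le_div_of_nonneg_left (abs_nonneg _) one_pos hsx.le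
        _ = |f s| := div_one _
    · rw [indicator_of_notMem hs, abs_zero]; exact abs_nonneg _
  · -- continuity in `x` at `x₀` for every `s ≠ x₀ + 1`
    have hae : ∀ᵐ s : ℝ, s ≠ x₀ + 1 := by simp [ae_iff, measure_singleton]
    filter_upwards [hae] with s hs
    rcases lt_or_gt_of_ne hs with hlt | hgt
    · -- s < x₀ + 1: the indicator vanishes near x₀
      have hev : ∀ᶠ x in 𝓝 x₀, s ∉ Ioi (x + 1) := by
        have : ∀ᶠ x in 𝓝 x₀, s - 1 < x := eventually_gt_nhds (by linarith)
        filter_upwards [this] with x hx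
        simp only [mem_Ioi, not_lt]; linarith
      refine (continuousAt_const (y := (0:ℝ))).congr ?_
      filter_upwards [hev] with x hx
      rw [indicator_of_notMem hx]
    · -- s > x₀ + 1: the indicator is 1 near x₀ and s − x ≠ 0
      have hev : ∀ᶠ x in 𝓝 x₀, s ∈ Ioi (x + 1) := by
        have : ∀ᶠ x in 𝓝 x₀, x < s - 1 := eventually_lt_nhds (by linarith)
        filter_upwards [this] with x hx
        simp only [mem_Ioi]; linarith
      have hcont : ContinuousAt (fun x => f s / (s - x)) x₀ :=
        (continuousAt_const.div (continuousAt_const.sub continuousAt_id) (by linarith : s - x₀ ≠ 0))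
      refine hcont.congr ?_
      filter_upwards [hev] with x hx
      rw [indicator_of_mem hx]

/-- The left far piece `x ↦ ∫ 𝟙_{s < x−1} f(s)/(x − s) ds` is continuous for `f ∈ L¹` continuous (domination by `|f|`). [folklore] -/
theorem continuous_farPiece_left {f : ℝ → ℝ} (hc : Continuous f) (hfi : Integrable f) :
    Continuous fun x => ∫ s, (Iio (x - 1)).indicator (fun s => f s / (x - s)) s := by
  refine continuous_iff_continuousAt.2 fun x₀ => ?_
  refine continuousAt_of_dominated (bound := fun s => |f s|) ?_ ?_ hfi.abs ?_
  · refine Eventually.of_forall fun x => ?_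
    exact ((hc.measurable.div (measurable_const.sub measurable_id)).aestronglyMeasurable.indicator measurableSet_Iio)
  · refine Eventually.of_forall fun x => Eventually.of_forall fun s => ?_
    rw [Real.norm_eq_abs]
    by_cases hs : s ∈ Iio (x - 1)
    · rw [indicator_of_mem hs, abs_div]
      have hsx : 1 < x - s := by simp only [mem_Iio] at hs; linarith
      rw [abs_of_pos (by linarith : (0:ℝ) < x - s)]
      calc |f s| / (x - s) ≤ |f s| / 1 := div_le_div_of_nonneg_left (abs_nonneg _) one_pos hsx.le
        _ = |f s| := div_one _
    · rw [indicator_of_notMem hs, abs_zero]; exact abs_nonneg _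
  · have hae : ∀ᵐ s : ℝ, s ≠ x₀ - 1 := by simp [ae_iff, measure_singleton]
    filter_upwards [hae] with s hs
    rcases lt_or_gt_of_ne hs with hlt | hgt
    · -- s < x₀ − 1: the indicator is 1 near x₀ and x − s ≠ 0
      have hev : ∀ᶠ x in 𝓝 x₀, s ∈ Iio (x - 1) := by
        have : ∀ᶠ x in 𝓝 x₀, s + 1 < x := eventually_gt_nhds (by linarith)
        filter_upwards [this] with x hx
        simp only [mem_Iio]; linarith
      have hcont : ContinuousAt (fun x => f s / (x - s)) x₀ :=
        (continuousAt_const.div (continuousAt_id.sub continuousAt_const) (by linarith : x₀ - s ≠ 0))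
      refine hcont.congr ?_
      filter_upwards [hev] with x hx
      rw [indicator_of_mem hx]
    · -- s > x₀ − 1: the indicator vanishes near x₀
      have hev : ∀ᶠ x in 𝓝 x₀, s ∉ Iio (x - 1) := by
        have : ∀ᶠ x in 𝓝 x₀, x < s + 1 := eventually_lt_nhds (by linarith)
        filter_upwards [this] with x hx
        simp only [mem_Iio, not_lt]; linarith
      refine (continuousAt_const (y := (0:ℝ))).congr ?_
      filter_upwards [hev] with x hx
      rw [indicator_of_notMem hx]

/-- For `f ∈ L¹` continuous and `t > 1`, `t ↦ f(x ∓ t)/t` is integrable on `(1, ∞)` (domination by `|f(x ∓ t)|`). [folklore] -/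
theorem integrableOn_farPieces {f : ℝ → ℝ} (hc : Continuous f) (hfi : Integrable f) (x : ℝ) :
    IntegrableOn (fun t => f (x - t) / t) (Ioi (1 : ℝ)) ∧ IntegrableOn (fun t => f (x + t) / t) (Ioi (1 : ℝ)) := by
  have key : ∀ g : ℝ → ℝ, Continuous g → Integrable g → IntegrableOn (fun t => g t / t) (Ioi (1 : ℝ)) := by
    intro g hg hgi
    refine Integrable.mono' hgi.abs.integrableOn ((hg.measurable.div measurable_id).aestronglyMeasurable.restrict) ?_
    refine ae_restrict_of_forall_mem measurableSet_Ioi fun t ht => ?_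
    have ht1 : 1 < t := ht
    rw [Real.norm_eq_abs, abs_div, abs_of_pos (by linarith : (0:ℝ) < t)]
    calc |g t| / t ≤ |g t| / 1 := div_le_div_of_nonneg_left (abs_nonneg _) one_pos ht1.le
      _ = |g t| := div_one _
  exact ⟨key _ (hc.comp (continuous_const.sub continuous_id)) (hfi.comp_sub_left x),
    key _ (hc.comp (continuous_const.add continuous_id)) (hfi.comp_add_left x)⟩

/-- **Split of the Hilbert transform of `f ∈ C¹ ∩ L¹`** into the near piece and the two substituted far pieces:
`Hf(x) = π⁻¹·(∫_{(0,1]} (f(x−t) − f(x+t))/t dt + ∫ 𝟙_{s<x−1} f(s)/(x−s) ds − ∫ 𝟙_{s>x+1} f(s)/(s−x) ds)`. [folklore] -/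
theorem hilbertTransform_eq_near_add_far {f : ℝ → ℝ} (hf : ContDiff ℝ 1 f) (hfi : Integrable f) (x : ℝ) :
    hilbertTransform f x = π⁻¹ * ((∫ t in Ioc (0 : ℝ) 1, (f (x - t) - f (x + t)) / t)
      + ((∫ s, (Iio (x - 1)).indicator (fun s => f s / (x - s)) s) - ∫ s, (Ioi (x + 1)).indicator (fun s => f s / (s - x)) s)) := by
  have hint := integrableOn_symmIntegrand_of_contDiff hf hfi x
  have hsplit : Ioi (0 : ℝ) = Ioc 0 1 ∪ Ioi 1 := (Ioc_union_Ioi_eq_Ioi zero_le_one).symm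
  rw [hilbertTransform, hsplit, setIntegral_union (Set.Ioc_disjoint_Ioi le_rfl) measurableSet_Ioi
    (hint.mono_set (by rw [hsplit]; exact subset_union_left)) (hint.mono_set (by rw [hsplit]; exact subset_union_right))]
  congr 2
  obtain ⟨hL, hR⟩ := integrableOn_farPieces hf.continuous hfi x
  rw [← farPiece_left_eq f x, ← farPiece_right_eq f x, ← integral_sub hL hR]
  refine setIntegral_congr_fun measurableSet_Ioi fun t _ => ?_
  ring

/-- **The Hilbert transform of a `C¹ ∩ L¹` function is continuous** (as the pointwise p.v. function `hilbertTransform f`). [folklore] -/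
theorem continuous_hilbertTransform_of_contDiff {f : ℝ → ℝ} (hf : ContDiff ℝ 1 f) (hfi : Integrable f) :
    Continuous (hilbertTransform f) := by
  have h : hilbertTransform f = fun x => π⁻¹ * ((∫ t in Ioc (0 : ℝ) 1, (f (x - t) - f (x + t)) / t)
      + ((∫ s, (Iio (x - 1)).indicator (fun s => f s / (x - s)) s) - ∫ s, (Ioi (x + 1)).indicator (fun s => f s / (s - x)) s)) :=
    funext (hilbertTransform_eq_near_add_far hf hfi)
  rw [h]
  exact continuous_const.mul ((continuous_nearPiece hf).add
    ((continuous_farPiece_left hf.continuous hfi).sub (continuous_farPiece_right hf.continuous hfi)))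

end SheetRWeakProfilePV
end Summit.NavierStokesRegularity.OSWSelfSimilar

end
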